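/-
Copyright (c) 2026 the pub-hodgecm-mathlib formalisation cell (harness21).  Prover seat hodgecm-mathlib-R90-C14-p04 (g0) (free R90-TF hand routed to L1 by
CHAIR VALVE WORD W4), Track B «K2-LIT» ∕ hLiu418 #184♮, Road I v3, unit U5 «THE CLOSE»: FACE-D₀ row `h2₂` «line lifts have rank ≤ 1» — brick (B5-fin) of the
census `R90/R90-C14-p04/g0/CENSUS-h22-LineLiftRankRow.R90-C14-p04-g0.md` (SIG R90∕K2 bus 23:14Z).  THEOREMS ONLY.  2026-09-04.
-/
import Summits.HodgeConjecture.HodgeConjecture.Theorems.K2LiuFirstTermLineLiftRankRow   -- ★ p862821 (this seat, B4): `fourierCoeffDelta_thetaLift_pairRep_unipDelta` (quasi-invariance), §2 row shape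
import Summits.HodgeConjecture.HodgeConjecture.Theorems.K2LiuRankOneLineGram           -- ★ U2c file 1 §1′: `eq_zero_of_functional_rankTwo_conj` (σ-twin of ★ U2a's head)
import HarnessLib

/-!
# K2_Liu road (hLiu418 = stmt-HodgeConjecture-24832), Road I v3, U5 «THE CLOSE», FACE-D₀ row `h2₂` «LINE LIFTS HAVE RANK ≤ 1», brick (B5-fin):
# the coefficient functional `Λ_S` VANISHES — ★ U2a (σ-twin) applied DIRECTLY on the finite-adelic Schwartz–Bruhat factor

Cell `pub/hodgecm-mathlib` (D-0151), Track B, build stream 29; helper lane `--supports stmt-HodgeConjecture-24832 --as helper`, count-neutral.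
★ p862821 (B4) reduced FACE-D′'s row `h2₂` at the witnesses of record (`T₂ = Θ̃^□_{𝓣·}(fw)`, `coeff β := cf (T_L⁻¹β)`) to ONE letter
`hΛ : ∀ Φ, cf_S(Θ̃_Φ(fw))(1) = 0` and proved the functional `Λ_S : Φ ↦ cf_S(Θ̃_Φ(fw))(1)` `(N_Δ(𝔸), ψ_S)`-QUASI-INVARIANT through `ω ∘ toDiagA`.  THIS FILE pays `hΛ`
from ★ U2a, read on the FINITE-ADELIC factor: `𝒮(𝔸^{n″}) ≅ 𝓢((L⁺⊗ℝ)^{n″}) ⊗ 𝒮(𝔸_f^{n″})` (★ `piSchwartzBruhatEquiv`) and `𝒮(𝔸_f^{n″}) = SchwartzBruhat (𝔸_f^{n″})` IS a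
Schwartz–Bruhat space of a topological space, on which ★ U2a's σ-twin `K2LiuRankOneLineGram.eq_zero_of_functional_rankTwo_conj` (ANY topological `X`, ANY group `Z`
acting by locally constant multipliers `x ↦ ψ(⟪b z, a·σ(v x) ⊗ v x⟫)` with a rank-≤-1 moment map) kills every `ψ_β`-semi-invariant functional for `det β ≠ 0` — so NO
slot factorisation is needed: `Z = N_{Δ,w}` at ONE finite place `w`, `v x` = the `w`-coordinates of `x ∈ 𝔸_f^{n″}`.

LETTERS BY VALUE (hypothesis-first, exactly as ★ p862640 ∕ ★ p862914 treat their sides):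
(i) the LINEAR READINGS `Bl` of the lift (★ (t) `exists_linearLift`: `Bl Φ h = Θ̃_Φ(fw)(h)`) and `cfS` of the coefficient on a class `P ∋ Bl Φ` (★ (c));
(ii) the σ-explicit LINE MODEL at `w` on `X := 𝔸_f^{n″}` — ★ U2a §1′ binders VERBATIM (`σ hσ hσF π hπ ψ hψ ρf b hb a ha v hu hρ`), the index `βloc` read in the model
(`hherm`, `hdet`) and its multiplier character `χ` (`hχ`);
(iii) THE ONE WEIL LETTER (census (B1-fin)): the model's group `Z` sits in `N_Δ(𝔸)` (`ι`) and `ω(toDiagA (ι z), 1)` acts on `Φ_∞ ⊗ φ` by `Φ_∞ ⊗ ρf(z)φ` (`hI`),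
with `χ = ψ_S ∘ ι` (`hχS`).
* **`fourierCoeffDelta_thetaLift_eq_zero_of_finLineModel`** — CONCLUSION `∀ Φ, cf_S(Θ̃_Φ(fw))(1) = 0` (= ★ p862821 §2's `hΛ`).  Proof: `Λ_S := ev₁ ∘ cfS ∘ codRestrict P Bl`
  is linear; for each archimedean vector `Φ_∞`, `Λ_{Φ_∞} := Λ_S ∘ equiv ∘ (Φ_∞ ⊗ ·)` is `(Z, χ)`-semi-invariant on `𝒮(𝔸_f^{n″})` (`hI` + ★ B4 quasi-invariance + `hχS`), hence
  `0` by ★ U2a; pure tensors generate `𝒮(𝔸^{n″})` (`TensorProduct.induction_on` through ★ `piSchwartzBruhatEquiv`), so `Λ_S = 0`.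
* **`h2Row_thetaSide_of_finLineModel`** — the FACE-D′ bytes `cfS ∘ₗ codRestrict P T₂ hP₂ = 0` at any carrier `𝓣` and theta functional `T₂` (★ p862821 §2 fed by the above).
After this file row `h2₂` is ★ modulo (B1-fin) `hI`/`hχS` and the model's structure letters (ii) — the slot-`w` Schrödinger model of `ω|_{N_Δ}`, census (B1).

No definition, no instance, no notation, no named-fact hypothesis, no `sorry`; axioms ⊆ {propext, Classical.choice, Quot.sound}.  HONEST LABEL: HC_CM is proved only modulo
the 7 printed citations (2 remaining named inputs: hLiu418 = stmt-HodgeConjecture-24832, h413 = stmt-HodgeConjecture-24833) until rung 0 closes; this file moves no counter.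

References: [Rallis1984] S. Rallis, Compositio Math. 51 (1984) §4; [Kudla1986] S. S. Kudla, Invent. Math. 83 (1986) proof of Thm. 2.8; [KudlaRallis1994] S. Kudla,
S. Rallis, Ann. of Math. 140 (1994) §3; [MoeglinVignerasWaldspurger1987] LNM 1291, Chap. 3 §IV.5; [Weil1964] A. Weil, Acta Math. 111 (1964) Chap. III n° 41 Thm 6 p. 193;
[Liu2021] Y. Liu, Camb. J. Math. 9 (2021) App. B Prop. B.8 p. 104.
-/

set_option autoImplicit false
set_option linter.dupNamespace false
-- statements over the adelic dual-pair carriers elaborate to very large types; elaborate sequentially (as in ★ `K2LiuLineThetaFunctionalOfRecord`)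
set_option Elab.async false

noncomputable section

open NumberField NumberField.mixedEmbedding MeasureTheory IsDedekindDomain
open scoped Matrix ComplexOrder ENNReal TensorProduct SchwartzMap Classical  -- `Classical`: the `Fintype` of real ∕ complex places inside `mixedSpace (L⁺)` (as ★ p862586)

namespace Summit.HodgeConjecture.HodgeConjecture.Cruxes.HLiu418.K2LiuFirstTermLineLiftRankRowModel

open Literature.NumberTheory.Automorphic Literature.NumberTheory.Automorphic.UnitaryGroup
open Literature.NumberTheory.Automorphic.IdeleClassGroup
open Literature.NumberTheory.Automorphic.Liu2021
open Literature.NumberTheory.Automorphic.Liu2021.Def411WeilCarriers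
open Literature.NumberTheory.Automorphic.Liu2021.Def411WeilCarriersDoubling
open Literature.NumberTheory.GelbartRogawski1991 Literature.NumberTheory.GelbartRogawski1991.UnitaryDualPair
open Literature.NumberTheory.GelbartRogawski1991.GRConstruction
open Literature.NumberTheory.GaloisRepresentations
open Literature.NumberTheory.Weil1964
open Literature.RepresentationTheory Literature.RepresentationTheory.Liu2021
open Literature.NumberTheory.K2Lit.DoubledLineTheta Literature.NumberTheory.K2Lit.SiegelDoubled
open Literature.MeasureTheory.Group
open Summit.HodgeConjecture.HodgeConjecture.Cruxes.HLiu418.K2LiuSiegelUnipotentFourierDefs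
open Summit.HodgeConjecture.HodgeConjecture.Cruxes.HLiu418.K2LiuSiegelUnipotentCharacters
open Summit.HodgeConjecture.HodgeConjecture.Cruxes.HLiu418.K2LiuUnipotentCoveringWeight
open Summit.HodgeConjecture.HodgeConjecture.Cruxes.HLiu418.K2LiuFirstTermLineLiftRankRow
open Summit.HodgeConjecture.HodgeConjecture.Cruxes.HLiu418.K2LiuRankOneLineGram (eq_zero_of_functional_rankTwo_conj)

variable (L : Type) [Field L] [NumberField L] [IsCMField L]
variable {N n : ℕ} (e : Fin N × Fin 1 ≃ Fin n)
  (dV : Fin N → L) (hdV : ∀ i, IsCMField.complexConj L (dV i) = dV i)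
  (dW : Fin 1 → L) (hdW : ∀ i, IsCMField.complexConj L (dW i) = dW i)
  {n'' : ℕ} (e₁ : Fin (n + n) × Fin 1 ≃ Fin n'')
  (hdV0 : ∀ i, dV i ≠ 0) (hdW0 : ∀ i, dW i ≠ 0)
  (lam : IdeleClassGroup L →ₜ* Circle) (hlam : IsConjugateSymplectic L lam) (a' : (Fp L)ˣ)
  (hρ : HasThetaMajorants fun
      (p : ↥(UnitaryGroup.adelic (Fp L) L (IsCMField.complexConj L) (n + n) (Matrix.diagonal (dD L e dV hdV dW hdW))) ×
        ↥(UnitaryGroup.adelic (Fp L) L (IsCMField.complexConj L) 1 (JW (Fp L) L a')))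
      (Φ : piSchwartzBruhat (Fp L) (Fin n'')) =>
        pairRep (Fp L) L (IsCMField.complexConj L) (n + n) 1 e₁ (Matrix.diagonal (dD L e dV hdV dW hdW)) (JW (Fp L) L a')
          (chiSplittingLine L e₁ (dD L e dV hdV dW hdW) (dD_conj L e dV hdV dW hdW) (dD_ne_zero L e dV hdV dW hdW hdV0 hdW0)
            (toHeckeCharacter L lam) (isUnitary_toHeckeCharacter L lam)
            ((isOscillatorChar_toHeckeCharacter_iff lam).mpr hlam) (TW (Fp L) a')
            (isUnit_det_TW (Fp L) a') (JW (Fp L) L a') (JW_eq (Fp L) L a'))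
          p Φ)
  [MeasurableSpace (↥(UnitaryGroup.adelic (Fp L) L (IsCMField.complexConj L) 1 (JW (Fp L) L a')) ⧸
    (UnitaryGroup.toAdelic (Fp L) L (IsCMField.complexConj L) 1 (JW (Fp L) L a')).range)]
  [BorelSpace (↥(UnitaryGroup.adelic (Fp L) L (IsCMField.complexConj L) 1 (JW (Fp L) L a')) ⧸
    (UnitaryGroup.toAdelic (Fp L) L (IsCMField.complexConj L) 1 (JW (Fp L) L a')).range)]
  (μW : Measure (↥(UnitaryGroup.adelic (Fp L) L (IsCMField.complexConj L) 1 (JW (Fp L) L a')) ⧸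
    (UnitaryGroup.toAdelic (Fp L) L (IsCMField.complexConj L) 1 (JW (Fp L) L a')).range)) [IsFiniteMeasure μW]
  (fw : C(↥(UnitaryGroup.adelic (Fp L) L (IsCMField.complexConj L) 1 (JW (Fp L) L a')) ⧸
    (UnitaryGroup.toAdelic (Fp L) L (IsCMField.complexConj L) 1 (JW (Fp L) L a')).range, ℂ))
  [MeasurableSpace (unipDelta L e dV hdV dW hdW)] [BorelSpace (unipDelta L e dV hdV dW hdW)]
  (νN : Measure (unipDelta L e dV hdV dW hdW)) [νN.IsMulLeftInvariant]
  {βw : unipDelta L e dV hdV dW hdW → ℝ≥0∞} (hβ : IsCoveringWeight (unipDeltaRat L e dV hdV dW hdW) βw) (hβtop : ∫⁻ u, βw u ∂νN ≠ ∞)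
  (S : Matrix (Fin n) (Fin n) L)

/-! ## The letters: linear readings of the lift and of the coefficient, and the σ-explicit line model on `𝒮(𝔸_f^{n″})` -/

variable
  -- (i) ★ (t): the lift as a linear map of `Φ`, and ★ (c): the coefficient as a linear map on a class `P ∋ Bl Φ`
  (Bl : ↥(piSchwartzBruhat (Fp L) (Fin n'')) →ₗ[ℂ] (HA L e dV hdV dW hdW → ℂ))
  (hBl : ∀ (Φ : piSchwartzBruhat (Fp L) (Fin n'')) (h : HA L e dV hdV dW hdW),
    Bl Φ h = doubledLineThetaLift L e dV hdV dW hdW e₁ hdV0 hdW0 lam hlam a' hρ μW Φ fw h)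
  (P : Submodule ℂ (HA L e dV hdV dW hdW → ℂ)) (hPB : ∀ Φ, Bl Φ ∈ P) (cfS : ↥P →ₗ[ℂ] (HA L e dV hdV dW hdW → ℂ))
  (hcf : ∀ (y : ↥P) (h : HA L e dV hdV dW hdW), cfS y h = fourierCoeffDelta L e dV hdV dW hdW νN βw S (y : HA L e dV hdV dW hdW → ℂ) h)
  -- (ii) the σ-explicit line model at one finite place, on the finite-adelic Schwartz–Bruhat space (★ U2a §1′ binders verbatim)
  {R : Type*} [CommRing R] {F : Type*} [Field F] [Algebra F R]
  (σ : R →+* R) (hσ : ∀ x, σ (σ x) = x) (hσF : ∀ c : F, σ (algebraMap F R c) = algebraMap F R c)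
  (π : Matrix (Fin 2) (Fin 2) R →ₗ[F] Matrix (Fin 2) (Fin 2) R →ₗ[F] F)
  (hπ : ∀ H : Matrix (Fin 2) (Fin 2) R, (H.map σ)ᵀ = H → H ≠ 0 → ∃ s : Matrix (Fin 2) (Fin 2) R, (s.map σ)ᵀ = s ∧ π s H ≠ 0)
  (ψ : AddChar F Circle) (hψ : ∃ t : F, ((ψ t : Circle) : ℂ) ≠ 1)
  {Z : Type*} [Group Z] (ρf : Representation ℂ Z (FinSB (Fp L) (Fin n'')))
  (b : Z → Matrix (Fin 2) (Fin 2) R) (hb : ∀ s : Matrix (Fin 2) (Fin 2) R, (s.map σ)ᵀ = s → ∃ z, b z = s)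
  (a : R) (ha : σ a = a) (v : (Fin n'' → FiniteAdeleRing (𝓞 (Fp L)) (Fp L)) → Fin 2 → R)
  (hu : ∀ z, IsLocallyConstant fun x => ((ψ (π (b z) (a • Matrix.vecMulVec (⇑σ ∘ v x) (v x))) : Circle) : ℂ))
  (hρm : ∀ (z : Z) (φ : FinSB (Fp L) (Fin n'')),
    ((ρf z φ : FinSB (Fp L) (Fin n'')) : (Fin n'' → FiniteAdeleRing (𝓞 (Fp L)) (Fp L)) → ℂ) =
      (fun x => ((ψ (π (b z) (a • Matrix.vecMulVec (⇑σ ∘ v x) (v x))) : Circle) : ℂ)) * φ)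
  (βloc : Matrix (Fin 2) (Fin 2) R) (hherm : (βloc.map σ)ᵀ = βloc) (hdet : βloc.det ≠ 0)
  (χ : Z →* ℂˣ) (hχ : ∀ z, ((χ z : ℂˣ) : ℂ) = ((ψ (π (b z) βloc) : Circle) : ℂ))
  -- (iii) THE WEIL LETTER (B1-fin): `Z ≤ N_Δ(𝔸)` acting on `Φ_∞ ⊗ φ` through the model, and `χ = ψ_S ∘ ι`
  (ι : Z → unipDelta L e dV hdV dW hdW)
  (hI : ∀ (z : Z) (Φinf : 𝓢((Fin n'' → mixedSpace (Fp L)), ℂ)) (φ : FinSB (Fp L) (Fin n'')),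
    pairRep (Fp L) L (IsCMField.complexConj L) (n + n) 1 e₁ (Matrix.diagonal (dD L e dV hdV dW hdW)) (JW (Fp L) L a')
        (chiSplittingLine L e₁ (dD L e dV hdV dW hdW) (dD_conj L e dV hdV dW hdW) (dD_ne_zero L e dV hdV dW hdW hdV0 hdW0)
          (toHeckeCharacter L lam) (isUnitary_toHeckeCharacter L lam)
          ((isOscillatorChar_toHeckeCharacter_iff lam).mpr hlam) (TW (Fp L) a')
          (isUnit_det_TW (Fp L) a') (JW (Fp L) L a') (JW_eq (Fp L) L a'))
        (toDiagA L e dV hdV dW hdW ((ι z : unipDelta L e dV hdV dW hdW) : HA L e dV hdV dW hdW), 1)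
        (piSchwartzBruhatEquiv (Fp L) (Fin n'') (Φinf ⊗ₜ[ℂ] φ)) =
      piSchwartzBruhatEquiv (Fp L) (Fin n'') (Φinf ⊗ₜ[ℂ] ρf z φ))
  (hχS : ∀ z : Z, ((χ z : ℂˣ) : ℂ) = (unipDeltaChar L e dV hdV dW hdW S (((ι z : unipDelta L e dV hdV dW hdW)) : HA L e dV hdV dW hdW) : ℂ))

include hBl hPB hcf hβ hβtop hσ hσF hπ hψ hb ha hu hρm hherm hdet hχ hI hχS

set_option maxHeartbeats 1000000 in -- the theta-kernel datum's statement telescope (as ★ p862821 ∕ ★ U4)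
/-- **`Λ_S ≡ 0`: THE `S`-TH FOURIER COEFFICIENT OF THE DOUBLED LINE THETA LIFT VANISHES AT `1` FOR EVERY `Φ`** — from ★ U2a (σ-twin) on the finite-adelic factor.
`Λ_S := ev₁ ∘ cfS ∘ codRestrict P Bl` is linear in `Φ`; on pure tensors `Φ_∞ ⊗ φ` the functional `φ ↦ Λ_S(Φ_∞ ⊗ φ)` on `𝒮(𝔸_f^{n″})` is `(Z, χ)`-semi-invariant — the model's
`z` acts as `ω(toDiagA (ι z), 1)` (`hI`), under which `Λ_S` picks up `ψ_S(ι z) = χ z` (★ p862821 `fourierCoeffDelta_thetaLift_pairRep_unipDelta`, `hχS`) — so it is `0` by ★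
`eq_zero_of_functional_rankTwo_conj` (`det βloc ≠ 0`: the Gram matrix `a·σ(v x) ⊗ v x` of a pair in a LINE has rank ≤ 1); pure tensors generate (★ `piSchwartzBruhatEquiv`).
[cite: Rallis1984, §4] [cite: Kudla1986, proof of Thm. 2.8] [cite: KudlaRallis1994, §3] [cite: MoeglinVignerasWaldspurger1987, Chap. 3 §IV.5] -/
theorem fourierCoeffDelta_thetaLift_eq_zero_of_finLineModel (Φ : piSchwartzBruhat (Fp L) (Fin n'')) :
    fourierCoeffDelta L e dV hdV dW hdW νN βw S (doubledLineThetaLift L e dV hdV dW hdW e₁ hdV0 hdW0 lam hlam a' hρ μW Φ fw) 1 = 0 := by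
  -- the linear functional `Λ_S Φ := cfS ⟨Bl Φ, _⟩ 1` and its pointwise reading
  let ΛS : ↥(piSchwartzBruhat (Fp L) (Fin n'')) →ₗ[ℂ] ℂ :=
    LinearMap.proj (1 : HA L e dV hdV dW hdW) ∘ₗ cfS ∘ₗ LinearMap.codRestrict P Bl hPB
  have hΛS : ∀ Ψ : piSchwartzBruhat (Fp L) (Fin n''),
      ΛS Ψ = fourierCoeffDelta L e dV hdV dW hdW νN βw S (doubledLineThetaLift L e dV hdV dW hdW e₁ hdV0 hdW0 lam hlam a' hρ μW Ψ fw) 1 := by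
    intro Ψ
    have hBΨ : ((LinearMap.codRestrict P Bl hPB Ψ : ↥P) : HA L e dV hdV dW hdW → ℂ) =
        doubledLineThetaLift L e dV hdV dW hdW e₁ hdV0 hdW0 lam hlam a' hρ μW Ψ fw := by
      rw [LinearMap.codRestrict_apply]
      exact funext (hBl Ψ)
    change cfS (LinearMap.codRestrict P Bl hPB Ψ) 1 = _
    rw [hcf, hBΨ]
  -- for each archimedean vector, the finite functional is `(Z, χ)`-semi-invariant, hence `0` by ★ U2a (σ-twin)
  have hfin : ∀ (Φinf : 𝓢((Fin n'' → mixedSpace (Fp L)), ℂ)) (φ : FinSB (Fp L) (Fin n'')),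
      ΛS (piSchwartzBruhatEquiv (Fp L) (Fin n'') (Φinf ⊗ₜ[ℂ] φ)) = 0 := by
    intro Φinf φ
    let Λa : FinSB (Fp L) (Fin n'') →ₗ[ℂ] ℂ :=
      ΛS ∘ₗ (piSchwartzBruhatEquiv (Fp L) (Fin n'')).toLinearMap ∘ₗ TensorProduct.mk ℂ (𝓢((Fin n'' → mixedSpace (Fp L)), ℂ)) (FinSB (Fp L) (Fin n'')) Φinf
    have hΛa : ∀ φ' : FinSB (Fp L) (Fin n''), Λa φ' = ΛS (piSchwartzBruhatEquiv (Fp L) (Fin n'') (Φinf ⊗ₜ[ℂ] φ')) := fun φ' => rfl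
    have hsemi : ∀ (z : Z) (φ' : FinSB (Fp L) (Fin n'')), Λa (ρf z φ') = ((χ z : ℂˣ) : ℂ) • Λa φ' := by
      intro z φ'
      rw [hΛa, hΛa, ← hI, hΛS, hΛS, fourierCoeffDelta_thetaLift_pairRep_unipDelta L e dV hdV dW hdW e₁ hdV0 hdW0 lam hlam a' hρ μW fw νN βw S hβ hβtop,
        hχS, smul_eq_mul]
    have h0 : Λa = 0 :=
      eq_zero_of_functional_rankTwo_conj σ hσ hσF π hπ ψ hψ ρf b hb a ha v βloc hu hρm χ hχ hherm hdet Λa hsemi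
    rw [← hΛa, h0, LinearMap.zero_apply]
  -- pure tensors generate `𝒮(𝔸^{n″})`
  have hall : ∀ t : 𝓢((Fin n'' → mixedSpace (Fp L)), ℂ) ⊗[ℂ] FinSB (Fp L) (Fin n''), ΛS (piSchwartzBruhatEquiv (Fp L) (Fin n'') t) = 0 := by
    intro t
    induction t using TensorProduct.induction_on with
    | zero => rw [map_zero, map_zero]
    | tmul x y => exact hfin x y
    | add x y hx hy => rw [map_add, map_add, hx, hy, add_zero]
  have hΦ : Φ = piSchwartzBruhatEquiv (Fp L) (Fin n'') ((piSchwartzBruhatEquiv (Fp L) (Fin n'')).symm Φ) :=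
    ((piSchwartzBruhatEquiv (Fp L) (Fin n'')).apply_symm_apply Φ).symm
  rw [← hΛS, hΦ]
  exact hall _

set_option maxHeartbeats 1000000 in -- idem
/-- **ROW `h2₂` OF FACE-D′ FOR THE THETA SIDE, from the finite line model** (★ p862821 §2 `coeff_comp_codRestrict_thetaFunctional_eq_zero` fed by
`fourierCoeffDelta_thetaLift_eq_zero_of_finLineModel`): for every carrier `𝓣` and every linear `T₂` with the law `hT₂B` (★ p862640) and values in `P`,
`cfS ∘ₗ codRestrict P T₂ hP₂ = 0` — the bytes of `h2₂` at `coeff β := cfS`, `S := T_L⁻¹β` (hermitian `β`, `det β ≠ 0` ⇒ `det βloc ≠ 0` in the model), MODULO the Weil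
letter (B1-fin) `hI`∕`hχS` and the model's structure letters. [cite: Rallis1984, §4] [cite: KudlaRallis1994, §3] [cite: Liu2021, App. B Prop. B.8 p. 104] -/
theorem h2Row_thetaSide_of_finLineModel
    {D : Type*} [AddCommGroup D] [Module ℂ D] (𝓣 : D →ₗ[ℂ] piSchwartzBruhat (Fp L) (Fin n''))
    (T₂ : D →ₗ[ℂ] (HA L e dV hdV dW hdW → ℂ))
    (hT₂B : ∀ (x : D) (h : HA L e dV hdV dW hdW),
      T₂ x h = doubledLineThetaLift L e dV hdV dW hdW e₁ hdV0 hdW0 lam hlam a' hρ μW (𝓣 x) fw h)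
    (hP₂ : ∀ x, T₂ x ∈ P) :
    cfS ∘ₗ LinearMap.codRestrict P T₂ hP₂ = 0 :=
  coeff_comp_codRestrict_thetaFunctional_eq_zero L e dV hdV dW hdW e₁ hdV0 hdW0 lam hlam a' hρ μW fw νN βw S P cfS hcf 𝓣 T₂ hT₂B hP₂
    (fourierCoeffDelta_thetaLift_eq_zero_of_finLineModel L e dV hdV dW hdW e₁ hdV0 hdW0 lam hlam a' hρ μW fw νN hβ hβtop S Bl hBl P hPB cfS hcf
      σ hσ hσF π hπ ψ hψ ρf b hb a ha v hu hρm βloc hherm hdet χ hχ ι hI hχS)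

/-! ## ED. 2 — the INTERTWINED form: the Weil letter for the TRUE finite action `ρW`, the multiplier model reached through an intertwiner `Tκ`

HONEST NOTE (ED. 2).  ED. 1's letter set asks ONE representation `ρf` to be BOTH the finite Weil action of the Siegel unipotents (`hI`) AND a multiplier
representation (`hρm`).  In the tree's model of `pairRep` (Schrödinger model of `adelicGram`, the CM real∕imaginary polarisation) the Siegel parabolic `P_Δ` of
the doubled group is NOT inside the model's Siegel parabolic `P_𝕐`: ★ (K-f) `K2LiuDoubledParabolicCayleyModel` moves it there by the CAYLEY MOVER `r_F(κ)`
(`ω(r_F κ · sD p · (r_F κ)⁻¹) = c(p) • ω(𝐫₀ q)`, `q = κ ι^𝔻(p) κ⁻¹ ∈ P_𝕐`, and ★ `coe_toOp_adelicSiegelLift` makes `ω(𝐫₀ q)` a chirp MULTIPLIER for unipotent `p`).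
So at the datum ED. 1's `{hI, hρm}` are jointly satisfiable only through an intertwiner; ED. 1's heads stay TRUE but are not the ones the payer can instantiate.
ED. 2 states the instantiable form: the true action `ρW` (letter `hIW` — ★ p863159 `K2LiuFirstTermLineLiftWeilLetterFin.pairRep_toDiagA_finAdelic_tmul` pays it BY
NAME), a linear automorphism `Tκ` of `𝒮(𝔸_f^{n″})` (the finite part of the Cayley mover) and the multiplier model `ρf` with `Tκ ∘ ρW z = ρf z ∘ Tκ` (`hT`).
The functional `Λ_{Φ_∞} ∘ Tκ⁻¹` is then `(Z, χ)`-semi-invariant for `ρf`, and ★ U2a kills it as before. -/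

omit hI in
set_option maxHeartbeats 1000000 in -- idem
/-- **`Λ_S ≡ 0`, INTERTWINED FORM (ED. 2)**: as `fourierCoeffDelta_thetaLift_eq_zero_of_finLineModel`, but the Weil letter is stated for the TRUE finite action
`ρW` of the Siegel unipotents (`hIW`, ★ p863159) and the σ-explicit multiplier model `ρf` is reached through a linear automorphism `Tκ` of `𝒮(𝔸_f^{n″})` intertwining
`ρW` with `ρf` (`hT` — the finite part of the Cayley mover of ★ (K-f)).  Proof: `Λ_{Φ_∞} ∘ Tκ⁻¹` is `(Z, χ)`-semi-invariant for `ρf` (`hIW` + ★ p862821 quasi-invariance +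
`hχS` + `hT`), hence `0` by ★ `eq_zero_of_functional_rankTwo_conj`; so `Λ_{Φ_∞} = 0` and `Λ_S = 0` on pure tensors, which generate.
[cite: Rallis1984, §4] [cite: Kudla1986, proof of Thm. 2.8] [cite: KudlaRallis1994, §3] [cite: Weil1964, Chap. I n° 13, Chap. III n° 37–38] -/
theorem fourierCoeffDelta_thetaLift_eq_zero_of_finLineModel_intertwined
    (ρW : Representation ℂ Z (FinSB (Fp L) (Fin n'')))
    (hIW : ∀ (z : Z) (Φinf : 𝓢((Fin n'' → mixedSpace (Fp L)), ℂ)) (φ : FinSB (Fp L) (Fin n'')),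
      pairRep (Fp L) L (IsCMField.complexConj L) (n + n) 1 e₁ (Matrix.diagonal (dD L e dV hdV dW hdW)) (JW (Fp L) L a')
          (chiSplittingLine L e₁ (dD L e dV hdV dW hdW) (dD_conj L e dV hdV dW hdW) (dD_ne_zero L e dV hdV dW hdW hdV0 hdW0)
            (toHeckeCharacter L lam) (isUnitary_toHeckeCharacter L lam)
            ((isOscillatorChar_toHeckeCharacter_iff lam).mpr hlam) (TW (Fp L) a')
            (isUnit_det_TW (Fp L) a') (JW (Fp L) L a') (JW_eq (Fp L) L a'))
          (toDiagA L e dV hdV dW hdW ((ι z : unipDelta L e dV hdV dW hdW) : HA L e dV hdV dW hdW), 1)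
          (piSchwartzBruhatEquiv (Fp L) (Fin n'') (Φinf ⊗ₜ[ℂ] φ)) =
        piSchwartzBruhatEquiv (Fp L) (Fin n'') (Φinf ⊗ₜ[ℂ] ρW z φ))
    (Tκ : FinSB (Fp L) (Fin n'') ≃ₗ[ℂ] FinSB (Fp L) (Fin n''))
    (hT : ∀ (z : Z) (φ : FinSB (Fp L) (Fin n'')), Tκ (ρW z φ) = ρf z (Tκ φ))
    (Φ : piSchwartzBruhat (Fp L) (Fin n'')) :
    fourierCoeffDelta L e dV hdV dW hdW νN βw S (doubledLineThetaLift L e dV hdV dW hdW e₁ hdV0 hdW0 lam hlam a' hρ μW Φ fw) 1 = 0 := by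
  -- the linear functional `Λ_S Φ := cfS ⟨Bl Φ, _⟩ 1` and its pointwise reading
  let ΛS : ↥(piSchwartzBruhat (Fp L) (Fin n'')) →ₗ[ℂ] ℂ :=
    LinearMap.proj (1 : HA L e dV hdV dW hdW) ∘ₗ cfS ∘ₗ LinearMap.codRestrict P Bl hPB
  have hΛS : ∀ Ψ : piSchwartzBruhat (Fp L) (Fin n''),
      ΛS Ψ = fourierCoeffDelta L e dV hdV dW hdW νN βw S (doubledLineThetaLift L e dV hdV dW hdW e₁ hdV0 hdW0 lam hlam a' hρ μW Ψ fw) 1 := by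
    intro Ψ
    have hBΨ : ((LinearMap.codRestrict P Bl hPB Ψ : ↥P) : HA L e dV hdV dW hdW → ℂ) =
        doubledLineThetaLift L e dV hdV dW hdW e₁ hdV0 hdW0 lam hlam a' hρ μW Ψ fw := by
      rw [LinearMap.codRestrict_apply]
      exact funext (hBl Ψ)
    change cfS (LinearMap.codRestrict P Bl hPB Ψ) 1 = _
    rw [hcf, hBΨ]
  -- for each archimedean vector: the finite functional transported by `Tκ⁻¹` is `(Z, χ)`-semi-invariant for the multiplier model, hence `0` by ★ U2a
  have hfin : ∀ (Φinf : 𝓢((Fin n'' → mixedSpace (Fp L)), ℂ)) (φ : FinSB (Fp L) (Fin n'')),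
      ΛS (piSchwartzBruhatEquiv (Fp L) (Fin n'') (Φinf ⊗ₜ[ℂ] φ)) = 0 := by
    intro Φinf φ
    let Λa : FinSB (Fp L) (Fin n'') →ₗ[ℂ] ℂ :=
      ΛS ∘ₗ (piSchwartzBruhatEquiv (Fp L) (Fin n'')).toLinearMap ∘ₗ TensorProduct.mk ℂ (𝓢((Fin n'' → mixedSpace (Fp L)), ℂ)) (FinSB (Fp L) (Fin n'')) Φinf
    have hΛa : ∀ φ' : FinSB (Fp L) (Fin n''), Λa φ' = ΛS (piSchwartzBruhatEquiv (Fp L) (Fin n'') (Φinf ⊗ₜ[ℂ] φ')) := fun φ' => rfl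
    -- semi-invariance for the TRUE action `ρW`
    have hsemiW : ∀ (z : Z) (φ' : FinSB (Fp L) (Fin n'')), Λa (ρW z φ') = ((χ z : ℂˣ) : ℂ) • Λa φ' := by
      intro z φ'
      rw [hΛa, hΛa, ← hIW, hΛS, hΛS, fourierCoeffDelta_thetaLift_pairRep_unipDelta L e dV hdV dW hdW e₁ hdV0 hdW0 lam hlam a' hρ μW fw νN βw S hβ hβtop,
        hχS, smul_eq_mul]
    -- transported to the multiplier model through `Tκ`
    let Λa' : FinSB (Fp L) (Fin n'') →ₗ[ℂ] ℂ := Λa ∘ₗ Tκ.symm.toLinearMap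
    have hΛa' : ∀ φ' : FinSB (Fp L) (Fin n''), Λa' φ' = Λa (Tκ.symm φ') := fun φ' => rfl
    have hsemi : ∀ (z : Z) (φ' : FinSB (Fp L) (Fin n'')), Λa' (ρf z φ') = ((χ z : ℂˣ) : ℂ) • Λa' φ' := by
      intro z φ'
      have hmove : Tκ.symm (ρf z φ') = ρW z (Tκ.symm φ') := by
        apply Tκ.injective
        rw [LinearEquiv.apply_symm_apply, hT, LinearEquiv.apply_symm_apply]
      rw [hΛa', hΛa', hmove, hsemiW]
    have h0 : Λa' = 0 :=
      eq_zero_of_functional_rankTwo_conj σ hσ hσF π hπ ψ hψ ρf b hb a ha v βloc hu hρm χ hχ hherm hdet Λa' hsemi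
    have hback : Λa φ = Λa' (Tκ φ) := by rw [hΛa', LinearEquiv.symm_apply_apply]
    rw [← hΛa, hback, h0, LinearMap.zero_apply]
  -- pure tensors generate `𝒮(𝔸^{n″})`
  have hall : ∀ t : 𝓢((Fin n'' → mixedSpace (Fp L)), ℂ) ⊗[ℂ] FinSB (Fp L) (Fin n''), ΛS (piSchwartzBruhatEquiv (Fp L) (Fin n'') t) = 0 := by
    intro t
    induction t using TensorProduct.induction_on with
    | zero => rw [map_zero, map_zero]
    | tmul x y => exact hfin x y
    | add x y hx hy => rw [map_add, map_add, hx, hy, add_zero]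
  have hΦ : Φ = piSchwartzBruhatEquiv (Fp L) (Fin n'') ((piSchwartzBruhatEquiv (Fp L) (Fin n'')).symm Φ) :=
    ((piSchwartzBruhatEquiv (Fp L) (Fin n'')).apply_symm_apply Φ).symm
  rw [← hΛS, hΦ]
  exact hall _

omit hI in
set_option maxHeartbeats 1000000 in -- idem
/-- **ROW `h2₂` OF FACE-D′ FOR THE THETA SIDE, INTERTWINED FORM (ED. 2)** — the instantiable head: `cfS ∘ₗ codRestrict P T₂ hP₂ = 0` from the TRUE Weil letter `hIW`
(★ p863159), the Cayley-mover intertwiner `Tκ`∕`hT` into the σ-explicit multiplier model (★ (K-f) lineage), and the model's structure letters; ★ p862821 §2 ∘ the above.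
[cite: Rallis1984, §4] [cite: KudlaRallis1994, §3] [cite: Liu2021, App. B Prop. B.8 p. 104] -/
theorem h2Row_thetaSide_of_finLineModel_intertwined
    (ρW : Representation ℂ Z (FinSB (Fp L) (Fin n'')))
    (hIW : ∀ (z : Z) (Φinf : 𝓢((Fin n'' → mixedSpace (Fp L)), ℂ)) (φ : FinSB (Fp L) (Fin n'')),
      pairRep (Fp L) L (IsCMField.complexConj L) (n + n) 1 e₁ (Matrix.diagonal (dD L e dV hdV dW hdW)) (JW (Fp L) L a')
          (chiSplittingLine L e₁ (dD L e dV hdV dW hdW) (dD_conj L e dV hdV dW hdW) (dD_ne_zero L e dV hdV dW hdW hdV0 hdW0)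
            (toHeckeCharacter L lam) (isUnitary_toHeckeCharacter L lam)
            ((isOscillatorChar_toHeckeCharacter_iff lam).mpr hlam) (TW (Fp L) a')
            (isUnit_det_TW (Fp L) a') (JW (Fp L) L a') (JW_eq (Fp L) L a'))
          (toDiagA L e dV hdV dW hdW ((ι z : unipDelta L e dV hdV dW hdW) : HA L e dV hdV dW hdW), 1)
          (piSchwartzBruhatEquiv (Fp L) (Fin n'') (Φinf ⊗ₜ[ℂ] φ)) =
        piSchwartzBruhatEquiv (Fp L) (Fin n'') (Φinf ⊗ₜ[ℂ] ρW z φ))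
    (Tκ : FinSB (Fp L) (Fin n'') ≃ₗ[ℂ] FinSB (Fp L) (Fin n''))
    (hT : ∀ (z : Z) (φ : FinSB (Fp L) (Fin n'')), Tκ (ρW z φ) = ρf z (Tκ φ))
    {D : Type*} [AddCommGroup D] [Module ℂ D] (𝓣 : D →ₗ[ℂ] piSchwartzBruhat (Fp L) (Fin n''))
    (T₂ : D →ₗ[ℂ] (HA L e dV hdV dW hdW → ℂ))
    (hT₂B : ∀ (x : D) (h : HA L e dV hdV dW hdW),
      T₂ x h = doubledLineThetaLift L e dV hdV dW hdW e₁ hdV0 hdW0 lam hlam a' hρ μW (𝓣 x) fw h)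
    (hP₂ : ∀ x, T₂ x ∈ P) :
    cfS ∘ₗ LinearMap.codRestrict P T₂ hP₂ = 0 :=
  coeff_comp_codRestrict_thetaFunctional_eq_zero L e dV hdV dW hdW e₁ hdV0 hdW0 lam hlam a' hρ μW fw νN βw S P cfS hcf 𝓣 T₂ hT₂B hP₂
    (fourierCoeffDelta_thetaLift_eq_zero_of_finLineModel_intertwined L e dV hdV dW hdW e₁ hdV0 hdW0 lam hlam a' hρ μW fw νN hβ hβtop S Bl hBl P hPB cfS hcf
      σ hσ hσF π hπ ψ hψ ρf b hb a ha v hu hρm βloc hherm hdet χ hχ ι hχS ρW hIW Tκ hT)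

end Summit.HodgeConjecture.HodgeConjecture.Cruxes.HLiu418.K2LiuFirstTermLineLiftRankRowModel

end
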